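import Summits.CriticalPhenomena.SAWScalingLimit.Theorems.SAWDefectDecoherenceBoundaryClosureRInnerZigzagEdges
import Summits.CriticalPhenomena.SAWScalingLimit.Theorems.SAWDefectDecoherenceBoundaryClosureRInnerPolygonsBoundaryPolygon
import Summits.CriticalPhenomena.SAWScalingLimit.Theorems.SAWDefectDecoherenceBoundaryClosureRInnerPolygonsFan
import HarnessLib

/-!
# Crux `BoundaryClosureR` (stmt-CriticalPhenomena-14004), line `polygon-parity-squeeze`,
# stub `stub_innerZigzagPolygon` (7a): the local structure of the inside of the boundary cycle —
# zigzag half-planes at side points, intersections / unions of two at the vertices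

Landing target:
`Summits/CriticalPhenomena/SAWScalingLimit/Theorems/SAWDefectDecoherenceBoundaryClosureRInnerZigzagLocal.lean`
(`--supports stmt-CriticalPhenomena-14004`; building block C2 of the registered stub
`stub_innerZigzagPolygon`, the continuum half of the inner-polygon construction (IP)).

Companion of `…InnerZigzagInside.lean` (same context: pinch-free `K`, boundary dart `d₀`, period `Per`,
polygonal domain `P`, outside `V`); the conclusions of that file — all `K`-faces at the vertices of
the cycle inside, all non-`K`-faces outside, the cycle inside the closed cells of the left and right
faces of the darts — are taken here as HYPOTHESES (`hin`, `hout`, `hΓ`, `hleft`, `hright`, `hsegΓ`), so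
that the two files are independent.  The inside is then read off locally:

* `carrier_inter_ball_vertex` — **at a vertex `y` of the cycle, `P ∩ B(y, 1/4)` is the interior of
  the union of the closed `K`-cells round `y`**, cut to the ball (cells cover the plane; a closed
  cell is the closure of its open cell; open cells are inside/outside; `Γ` lies in non-`K` cells);
* `vertex_shape` — hence, by the fan at the head (`fan_at_head`), the wedge dictionary
  (`triCell_faceL_iff_wedge`) and the fan algebra (`fan_interiors`), `P ∩ B(y, s)` (`s ≤ 1/4`) is
  `H_{σ j} ∩ H_{σ (j+4)}`, `H_{σ j} ∩ H_{σ (j+5)}`, `H_{σ j}`, `H_{σ j} ∪ H_{σ (j+1)}`, `H_{σ j} ∪ H_{σ (j+2)}`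
  (cut to the ball) according as the walk turns by `+2, +1, 0, -1, -2` at `y` (`j` the out-direction,
  `σ = ![0,3,5,1,2,4]`).  The corner / side-point consequences are in the sequel `…InnerZigzagSides.lean`.

Sources: folklore.  No definition and no named fact is introduced.
-/

noncomputable section

open scoped ComplexConjugate
open Set Metric
open Literature.Probability.LatticeModels
open Literature.Probability.Percolation (triX triY triCell triCellStrict triDir exists_mem_triCell
  eq_of_mem_triCellStrict_of_mem_triCell)
open Literature.Probability.RandomPlanarGeometry
open Summit.CriticalPhenomena.SAWScalingLimit.Theorems.PolygonParitySqueeze.BoundaryWalk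

namespace Summit.CriticalPhenomena.SAWScalingLimit.Theorems.PolygonParitySqueeze.InnerZigzag

variable {K : Finset HexVertex} {d₀ : Site 2 × Fin 6} {Per : ℕ}
  (hs : IsSimpleClosedPolygon (bverts K 0 1 d₀ Per)) (h₀ : d₀ ∈ bdDarts K)
  {V : Set ℂ} (hV : IsOpen V ∧ Disjoint (polygonDomain (bverts K 0 1 d₀ Per) hs).carrier V ∧
    (polygonDomain (bverts K 0 1 d₀ Per) hs).carrier ∪ V = (frontier (polygonDomain (bverts K 0 1 d₀ Per) hs).carrier)ᶜ ∧
    frontier V = frontier (polygonDomain (bverts K 0 1 d₀ Per) hs).carrier)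
  (hK : ∀ y : Site 2, (Finset.univ.filter fun k : Fin 6 => faceL y k ∈ K ∧ faceL y (k + 1) ∉ K).card ≤ 1)
  (hin : ∀ (t : ℕ) (i : Fin 6), faceL ((bwalk K d₀ t).1 + triDir (bwalk K d₀ t).2) i ∈ K →
    triCellStrict (faceL ((bwalk K d₀ t).1 + triDir (bwalk K d₀ t).2) i) ⊆ (polygonDomain (bverts K 0 1 d₀ Per) hs).carrier)
  (hout : ∀ (t : ℕ) (i : Fin 6), faceL ((bwalk K d₀ t).1 + triDir (bwalk K d₀ t).2) i ∉ K →
    triCellStrict (faceL ((bwalk K d₀ t).1 + triDir (bwalk K d₀ t).2) i) ⊆ V)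
  (hΓ : ∀ z ∈ frontier (polygonDomain (bverts K 0 1 d₀ Per) hs).carrier, ∃ t < Per,
    z ∈ triCell (faceL (bwalk K d₀ t).1 (bwalk K d₀ t).2) ∧ z ∈ triCell (faceL (bwalk K d₀ t).1 ((bwalk K d₀ t).2 + 5)) ∧
    faceL (bwalk K d₀ t).1 (bwalk K d₀ t).2 ∈ K ∧ faceL (bwalk K d₀ t).1 ((bwalk K d₀ t).2 + 5) ∉ K)
  (hleft : ∀ t : ℕ, triCellStrict (faceL (bwalk K d₀ t).1 (bwalk K d₀ t).2) ⊆ (polygonDomain (bverts K 0 1 d₀ Per) hs).carrier)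
  (hright : ∀ t : ℕ, triCellStrict (faceL (bwalk K d₀ t).1 ((bwalk K d₀ t).2 + 5)) ⊆ V)
  (hsegΓ : ∀ t : ℕ, segment ℝ (triEmbed (bwalk K d₀ t).1) (triEmbed ((bwalk K d₀ t).1 + triDir (bwalk K d₀ t).2)) ⊆
    frontier (polygonDomain (bverts K 0 1 d₀ Per) hs).carrier)

/-! ### 1. At a vertex: the interior of the union of the closed `K`-cells -/

include hV hin hout hΓ in
/-- **At a vertex of the cycle, the inside is the interior of the union of the closed `K`-cells
round it** (within the ball of radius `1/4`). [folklore] -/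
theorem carrier_inter_ball_vertex (t : ℕ) :
    (polygonDomain (bverts K 0 1 d₀ Per) hs).carrier ∩ ball (triEmbed ((bwalk K d₀ t).1 + triDir (bwalk K d₀ t).2)) (1 / 4) =
      interior (⋃ i : Fin 6, ⋃ (_ : faceL ((bwalk K d₀ t).1 + triDir (bwalk K d₀ t).2) i ∈ K),
          triCell (faceL ((bwalk K d₀ t).1 + triDir (bwalk K d₀ t).2) i)) ∩
        ball (triEmbed ((bwalk K d₀ t).1 + triDir (bwalk K d₀ t).2)) (1 / 4) := by
  set y := (bwalk K d₀ t).1 + triDir (bwalk K d₀ t).2 with hy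
  set P := (polygonDomain (bverts K 0 1 d₀ Per) hs).carrier with hP
  set U : Set ℂ := ⋃ i : Fin 6, ⋃ (_ : faceL y i ∈ K), triCell (faceL y i) with hU
  have hPo : IsOpen P := (polygonDomain (bverts K 0 1 d₀ Per) hs).isOpen
  have hin := hin t
  have hout := hout t
  have hnear : ∀ w ∈ ball (triEmbed y) (1 / 4), ‖w - triEmbed y‖ < 1 / 4 := fun w hw => by
    rwa [mem_ball, dist_eq_norm] at hw
  have hPΓ : ∀ w ∈ P, w ∉ frontier P := fun w hw hwf => by
    have : w ∈ P ∩ frontier P := ⟨hw, hwf⟩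
    rw [hPo.inter_frontier_eq] at this
    exact this
  apply Subset.antisymm
  · -- `P ∩ B ⊆ U`, and `P ∩ B` is open
    have hsub : P ∩ ball (triEmbed y) (1 / 4) ⊆ U := by
      rintro w ⟨hwP, hwB⟩
      obtain ⟨G, hG⟩ := exists_mem_triCell w
      obtain ⟨i, rfl⟩ := exists_faceL_of_mem_triCell y w (hnear w hwB) G hG
      by_cases hi : faceL y i ∈ K
      · exact mem_iUnion.2 ⟨i, mem_iUnion.2 ⟨hi, hG⟩⟩
      · exfalso
        have hcl : w ∈ closure V := closure_mono (hout i hi) (triCell_subset_closure_triCellStrict _ hG)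
        rw [closure_eq_self_union_frontier, hV.2.2.2] at hcl
        rcases hcl with h | h
        · exact Set.disjoint_left.1 hV.2.1 hwP h
        · exact hPΓ w hwP h
    intro w hw
    exact ⟨interior_maximal hsub (hPo.inter isOpen_ball) hw, hw.2⟩
  · rintro w ⟨hwU, hwB⟩
    rw [mem_interior_iff_mem_nhds, Metric.mem_nhds_iff] at hwU
    obtain ⟨ε, hε, hball⟩ := hwU
    have hwU' : w ∈ U := hball (mem_ball_self hε)
    -- `w` is off the cycle
    have hwΓ : w ∉ frontier P := by
      intro hwf
      obtain ⟨s, -, -, hzR, -, hR⟩ := hΓ w hwf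
      obtain ⟨i', hi'⟩ := exists_faceL_of_mem_triCell y w (hnear w hwB) _ hzR
      rw [hi'] at hzR hR
      have hcl := triCell_subset_closure_triCellStrict _ hzR
      obtain ⟨q, hqb, hqs⟩ := mem_closure_iff_nhds.1 hcl _ (ball_mem_nhds w hε)
      have hqU := hball hqb
      simp only [hU, mem_iUnion] at hqU
      obtain ⟨i, hi, hqi⟩ := hqU
      have := eq_of_mem_triCellStrict_of_mem_triCell hqs hqi
      rw [this] at hR
      exact hR hi
    have hwPV : w ∈ P ∪ V := by rw [hV.2.2.1]; exact hwΓ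
    rcases hwPV with h | h
    · exact ⟨h, hwB⟩
    · exfalso
      -- an inside point near `w ∈ V`
      obtain ⟨ε', hε', hball'⟩ := Metric.mem_nhds_iff.1 (hV.1.mem_nhds h)
      simp only [hU, mem_iUnion] at hwU'
      obtain ⟨i, hi, hwi⟩ := hwU'
      have hcl := triCell_subset_closure_triCellStrict _ hwi
      obtain ⟨q, hqb, hqs⟩ := mem_closure_iff_nhds.1 hcl _ (ball_mem_nhds w hε')
      exact Set.disjoint_left.1 hV.2.1 (hin i hi hqs) (hball' hqb)

/-! ### 2. The five shapes at a vertex -/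

omit hs h₀ hV hK hin hout hΓ hleft hright hsegΓ in
/-- Cutting a family of sets to a ball only sees the family inside the ball. [folklore] -/
theorem iUnion_inter_ball_congr {A A' : Fin 6 → Set ℂ} {p : Fin 6 → Prop} {c : ℂ} {s : ℝ}
    (h : ∀ i, ∀ w ∈ ball c s, w ∈ A i ↔ w ∈ A' i) :
    (⋃ i, ⋃ (_ : p i), A i) ∩ ball c s = (⋃ i, ⋃ (_ : p i), A' i) ∩ ball c s := by
  ext w
  simp only [mem_inter_iff, mem_iUnion]
  constructor
  · rintro ⟨⟨i, hi, hw⟩, hb⟩; exact ⟨⟨i, hi, (h i w hb).1 hw⟩, hb⟩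
  · rintro ⟨⟨i, hi, hw⟩, hb⟩; exact ⟨⟨i, hi, (h i w hb).2 hw⟩, hb⟩

omit hs h₀ hV hK hin hout hΓ hleft hright hsegΓ in
/-- Interiors of two sets which agree inside an open ball agree inside the ball. [folklore] -/
theorem interior_inter_ball_congr {U W : Set ℂ} {c : ℂ} {s : ℝ} (h : U ∩ ball c s = W ∩ ball c s) :
    interior U ∩ ball c s = interior W ∩ ball c s := by
  rw [← isOpen_ball.interior_eq, ← interior_inter, ← interior_inter, h]

omit hs h₀ hV hK hin hout hΓ hleft hright hsegΓ in
/-- The `60°` corner in the `σ` language: `H_{a j} ∩ H_{b j} = H_{σ j} ∩ H_{σ (j+4)}`. [folklore] -/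
theorem fan_one_sigma (j : Fin 6) (c : ℂ) :
    halfPlane (![2, 3, 5, 3, 2, 4] j) c ∩ halfPlane (![0, 4, 0, 1, 5, 1] j) c =
      halfPlane (![0, 3, 5, 1, 2, 4] j) c ∩ halfPlane (![0, 3, 5, 1, 2, 4] (j + 4)) c := by
  fin_cases j <;> simp [Set.inter_comm]

omit hs h₀ hV hK hin hout hΓ hleft hright hsegΓ in
/-- The `120°` corner in the `σ` language: `H_{p j} ∩ H_{q j} = H_{σ j} ∩ H_{σ (j+5)}`. [folklore] -/
theorem fan_two_sigma (j : Fin 6) (c : ℂ) :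
    halfPlane (![0, 3, 3, 1, 2, 4] j) c ∩ halfPlane (![4, 0, 5, 5, 1, 2] j) c =
      halfPlane (![0, 3, 5, 1, 2, 4] j) c ∩ halfPlane (![0, 3, 5, 1, 2, 4] (j + 5)) c := by
  fin_cases j <;> simp [Set.inter_comm]

omit hs h₀ hV hK hin hout hΓ hleft hright hsegΓ in
/-- `Fin 6` bookkeeping round a vertex (successors). [folklore] -/
theorem fin6_book (k : Fin 6) : k + 0 = k ∧ k + 1 + 1 = k + 2 ∧ k + 2 + 1 = k + 3 ∧ k + 3 + 1 = k + 4 ∧ k + 4 + 1 = k + 5 ∧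
    k + 5 + 1 = k :=
  ⟨add_zero k, by rw [add_assoc]; rfl, by rw [add_assoc]; rfl, by rw [add_assoc]; rfl, by rw [add_assoc]; rfl,
    by rw [add_assoc, show (5 : Fin 6) + 1 = 0 from rfl, add_zero]⟩

omit hs h₀ hV hK hin hout hΓ hleft hright hsegΓ in
/-- More `Fin 6` bookkeeping round a vertex. [folklore] -/
theorem fin6_succ' (k : Fin 6) : k + 5 + 2 = k + 1 ∧ k + 5 + 3 = k + 2 ∧ k + 4 + 2 = k ∧ k + 4 + 3 = k + 1 ∧
    k + 4 + 4 = k + 2 := by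
  refine ⟨by rw [add_assoc, show (5 : Fin 6) + 2 = 1 from rfl], by rw [add_assoc, show (5 : Fin 6) + 3 = 2 from rfl],
    by rw [add_assoc, show (4 : Fin 6) + 2 = 0 from rfl, add_zero], by rw [add_assoc, show (4 : Fin 6) + 3 = 1 from rfl],
    by rw [add_assoc, show (4 : Fin 6) + 4 = 2 from rfl]⟩

omit hs h₀ hV hK hin hout hΓ hleft hright hsegΓ in
/-- The out-directions of the five cases are pairwise distinct (`Fin 6` bookkeeping). [folklore] -/
theorem fin6_ne (k : Fin 6) : k + 2 ≠ k + 1 ∧ k + 2 ≠ k ∧ k + 2 ≠ k + 5 ∧ k + 2 ≠ k + 4 ∧ k + 1 ≠ k ∧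
    k + 1 ≠ k + 5 ∧ k + 1 ≠ k + 4 ∧ k ≠ k + 5 ∧ k ≠ k + 4 ∧ k + 5 ≠ k + 4 := by
  refine ⟨?_, ?_, ?_, ?_, ?_, ?_, ?_, ?_, ?_, ?_⟩ <;> intro h <;>
    first
    | exact absurd (add_left_cancel h) (by decide)
    | exact absurd (add_left_cancel (h.trans (add_zero k).symm)) (by decide)
    | exact absurd (add_left_cancel ((add_zero k).trans h)) (by decide)

include h₀ hV hK hin hout hΓ in
/-- **The five shapes at a vertex of the cycle.**  At the head `y` of the dart `t`, with in-direction
`k` and out-direction `j`, for `0 < s ≤ 1/4`: `P ∩ B(y, s)` is `H_{σ j} ∩ H_{σ (j+4)}` (`j = k+2`),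
`H_{σ j} ∩ H_{σ (j+5)}` (`j = k+1`), `H_{σ j}` (`j = k`), `H_{σ j} ∪ H_{σ (j+1)}` (`j = k+5`),
`H_{σ j} ∪ H_{σ (j+2)}` (`j = k+4`), each through `y` and cut to the ball (written with `j` spelled
as `k + c`). [folklore] -/
theorem vertex_shape (t : ℕ) {s : ℝ} (hs4 : s ≤ 1 / 4) :
    ((bwalk K d₀ (t + 1)).2 = (bwalk K d₀ t).2 + 2 ∧
      (polygonDomain (bverts K 0 1 d₀ Per) hs).carrier ∩ ball (triEmbed ((bwalk K d₀ t).1 + triDir (bwalk K d₀ t).2)) s =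
        halfPlane (![0, 3, 5, 1, 2, 4] ((bwalk K d₀ t).2 + 2)) (triEmbed ((bwalk K d₀ t).1 + triDir (bwalk K d₀ t).2)) ∩
          halfPlane (![0, 3, 5, 1, 2, 4] ((bwalk K d₀ t).2 + 2 + 4)) (triEmbed ((bwalk K d₀ t).1 + triDir (bwalk K d₀ t).2)) ∩
          ball (triEmbed ((bwalk K d₀ t).1 + triDir (bwalk K d₀ t).2)) s) ∨
    ((bwalk K d₀ (t + 1)).2 = (bwalk K d₀ t).2 + 1 ∧
      (polygonDomain (bverts K 0 1 d₀ Per) hs).carrier ∩ ball (triEmbed ((bwalk K d₀ t).1 + triDir (bwalk K d₀ t).2)) s =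
        halfPlane (![0, 3, 5, 1, 2, 4] ((bwalk K d₀ t).2 + 1)) (triEmbed ((bwalk K d₀ t).1 + triDir (bwalk K d₀ t).2)) ∩
          halfPlane (![0, 3, 5, 1, 2, 4] ((bwalk K d₀ t).2 + 1 + 5)) (triEmbed ((bwalk K d₀ t).1 + triDir (bwalk K d₀ t).2)) ∩
          ball (triEmbed ((bwalk K d₀ t).1 + triDir (bwalk K d₀ t).2)) s) ∨
    ((bwalk K d₀ (t + 1)).2 = (bwalk K d₀ t).2 ∧
      (polygonDomain (bverts K 0 1 d₀ Per) hs).carrier ∩ ball (triEmbed ((bwalk K d₀ t).1 + triDir (bwalk K d₀ t).2)) s =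
        halfPlane (![0, 3, 5, 1, 2, 4] (bwalk K d₀ t).2) (triEmbed ((bwalk K d₀ t).1 + triDir (bwalk K d₀ t).2)) ∩
          ball (triEmbed ((bwalk K d₀ t).1 + triDir (bwalk K d₀ t).2)) s) ∨
    ((bwalk K d₀ (t + 1)).2 = (bwalk K d₀ t).2 + 5 ∧
      (polygonDomain (bverts K 0 1 d₀ Per) hs).carrier ∩ ball (triEmbed ((bwalk K d₀ t).1 + triDir (bwalk K d₀ t).2)) s =
        (halfPlane (![0, 3, 5, 1, 2, 4] ((bwalk K d₀ t).2 + 5)) (triEmbed ((bwalk K d₀ t).1 + triDir (bwalk K d₀ t).2)) ∪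
          halfPlane (![0, 3, 5, 1, 2, 4] ((bwalk K d₀ t).2 + 5 + 1)) (triEmbed ((bwalk K d₀ t).1 + triDir (bwalk K d₀ t).2))) ∩
          ball (triEmbed ((bwalk K d₀ t).1 + triDir (bwalk K d₀ t).2)) s) ∨
    ((bwalk K d₀ (t + 1)).2 = (bwalk K d₀ t).2 + 4 ∧
      (polygonDomain (bverts K 0 1 d₀ Per) hs).carrier ∩ ball (triEmbed ((bwalk K d₀ t).1 + triDir (bwalk K d₀ t).2)) s =
        (halfPlane (![0, 3, 5, 1, 2, 4] ((bwalk K d₀ t).2 + 4)) (triEmbed ((bwalk K d₀ t).1 + triDir (bwalk K d₀ t).2)) ∪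
          halfPlane (![0, 3, 5, 1, 2, 4] ((bwalk K d₀ t).2 + 4 + 2)) (triEmbed ((bwalk K d₀ t).1 + triDir (bwalk K d₀ t).2))) ∩
          ball (triEmbed ((bwalk K d₀ t).1 + triDir (bwalk K d₀ t).2)) s) := by
  have hmain := carrier_inter_ball_vertex hs hV hin hout hΓ t
  have hdt := isBdDart_bwalk (K := K) h₀ t
  rw [bwalk_succ]
  rcases hxk : bwalk K d₀ t with ⟨x, k⟩
  rw [hxk] at hmain hdt
  simp only at hmain ⊢
  set y := x + triDir k with hy
  set P := (polygonDomain (bverts K 0 1 d₀ Per) hs).carrier with hP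
  set B := ball (triEmbed y) (1 / 4) with hB
  obtain ⟨e0, e11, e21, e31, e41, e51⟩ := fin6_book k
  obtain ⟨hK2, hK3, hcases⟩ := fan_at_head hK hdt
  -- the small ball
  have hsB : ball (triEmbed y) s ⊆ B := ball_subset_ball hs4
  have cut : ∀ A : Set ℂ, P ∩ B = A ∩ B → P ∩ ball (triEmbed y) s = A ∩ ball (triEmbed y) s := by
    intro A h
    rw [← inter_eq_self_of_subset_right hsB, ← inter_assoc, ← inter_assoc, h]
  -- cells are wedges inside `B`
  have hwedge : ∀ p : Fin 6 → Prop,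
      (⋃ i, ⋃ (_ : p i), triCell (faceL y i)) ∩ B =
        (⋃ i, ⋃ (_ : p i), (closedHalfPlane (![2, 3, 5, 3, 2, 4] i) (triEmbed y) ∩
          closedHalfPlane (![0, 4, 0, 1, 5, 1] i) (triEmbed y))) ∩ B := fun p =>
    iUnion_inter_ball_congr fun i w hw => triCell_faceL_iff_wedge y w (by rwa [mem_ball, dist_eq_norm] at hw) i
  -- the union over the `K`-faces, rewritten through a membership predicate
  have hU : ∀ p : Fin 6 → Prop, (∀ i, faceL y i ∈ K ↔ p i) →
      P ∩ B = interior (⋃ i, ⋃ (_ : p i), (closedHalfPlane (![2, 3, 5, 3, 2, 4] i) (triEmbed y) ∩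
          closedHalfPlane (![0, 4, 0, 1, 5, 1] i) (triEmbed y))) ∩ B := by
    intro p hp
    rw [hmain]
    have e : (⋃ i, ⋃ (_ : faceL y i ∈ K), triCell (faceL y i)) = ⋃ i, ⋃ (_ : p i), triCell (faceL y i) := by
      simp only [hp]
    rw [e]
    exact interior_inter_ball_congr (hwedge p)
  -- every face index is `k + c`
  have split : ∀ i : Fin 6, ∃ c : Fin 6, i = k + c := fun i => ⟨i - k, by abel⟩
  obtain ⟨n21, n20, n25, n24, n10, n15, n14, n05, n04, n54⟩ := fin6_ne k
  rcases hcases with ⟨hj, h1, hk0, h5, h4⟩ | ⟨hj, h1, hk0, h5, h4⟩ | ⟨hj, h1, hk0, h5, h4⟩ |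
    ⟨hj, h1, hk0, h5, h4⟩ | ⟨hj, h1, hk0, h5, h4⟩
  · -- `60°`: only `k+2`
    refine Or.inl ⟨hj, cut _ ?_⟩
    have hp : ∀ i, faceL y i ∈ K ↔ i = k + 2 := by
      intro i
      obtain ⟨c, rfl⟩ := split i
      have hc : c = 0 ∨ c = 1 ∨ c = 2 ∨ c = 3 ∨ c = 4 ∨ c = 5 := by fin_cases c <;> simp
      rcases hc with rfl | rfl | rfl | rfl | rfl | rfl
      · rw [e0]; exact ⟨fun h => absurd h hk0, fun h => absurd h.symm n20⟩
      · exact ⟨fun h => absurd h h1, fun h => absurd h.symm n21⟩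
      · exact ⟨fun _ => rfl, fun _ => hK2⟩
      · exact ⟨fun h => absurd h hK3, fun h => absurd (add_left_cancel h) (by decide)⟩
      · exact ⟨fun h => absurd h h4, fun h => absurd h.symm n24⟩
      · exact ⟨fun h => absurd h h5, fun h => absurd h.symm n25⟩
    rw [hU _ hp, iUnion_iUnion_eq_left, (fan_interiors (k + 2) (triEmbed y)).1, fan_one_sigma]
  · -- `120°`: `k+1, k+2`
    refine Or.inr (Or.inl ⟨hj, cut _ ?_⟩)
    have hp : ∀ i, faceL y i ∈ K ↔ i = k + 1 ∨ i = k + 1 + 1 := by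
      intro i
      rw [e11]
      obtain ⟨c, rfl⟩ := split i
      have hc : c = 0 ∨ c = 1 ∨ c = 2 ∨ c = 3 ∨ c = 4 ∨ c = 5 := by fin_cases c <;> simp
      rcases hc with rfl | rfl | rfl | rfl | rfl | rfl
      · rw [e0]; exact ⟨fun h => absurd h hk0, fun h => h.elim (fun h => absurd h.symm n10) fun h => absurd h.symm n20⟩
      · exact ⟨fun _ => Or.inl rfl, fun _ => h1⟩
      · exact ⟨fun _ => Or.inr rfl, fun _ => hK2⟩
      · exact ⟨fun h => absurd h hK3, fun h => h.elim (fun h => absurd (add_left_cancel h) (by decide))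
          fun h => absurd (add_left_cancel h) (by decide)⟩
      · exact ⟨fun h => absurd h h4, fun h => h.elim (fun h => absurd h.symm n14) fun h => absurd h.symm n24⟩
      · exact ⟨fun h => absurd h h5, fun h => h.elim (fun h => absurd h.symm n15) fun h => absurd h.symm n25⟩
    rw [hU _ hp, iUnion_iUnion_eq_or_left, iUnion_iUnion_eq_left, (fan_interiors (k + 1) (triEmbed y)).2.1, fan_two_sigma]
  · -- flat: `k, k+1, k+2`
    refine Or.inr (Or.inr (Or.inl ⟨hj, cut _ ?_⟩))
    have hp : ∀ i, faceL y i ∈ K ↔ i = k ∨ i = k + 1 ∨ i = k + 2 := by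
      intro i
      obtain ⟨c, rfl⟩ := split i
      have hc : c = 0 ∨ c = 1 ∨ c = 2 ∨ c = 3 ∨ c = 4 ∨ c = 5 := by fin_cases c <;> simp
      rcases hc with rfl | rfl | rfl | rfl | rfl | rfl
      · rw [e0]; exact ⟨fun _ => Or.inl rfl, fun _ => hk0⟩
      · exact ⟨fun _ => Or.inr (Or.inl rfl), fun _ => h1⟩
      · exact ⟨fun _ => Or.inr (Or.inr rfl), fun _ => hK2⟩
      · refine ⟨fun h => absurd h hK3, fun h => ?_⟩
        rcases h with h | h | h
        · exact absurd ((add_zero k).trans h.symm) (fun h => absurd (add_left_cancel h) (by decide))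
        · exact absurd (add_left_cancel h) (by decide)
        · exact absurd (add_left_cancel h) (by decide)
      · refine ⟨fun h => absurd h h4, fun h => ?_⟩
        rcases h with h | h | h
        · exact absurd h.symm n04
        · exact absurd h.symm n14
        · exact absurd h.symm n24
      · refine ⟨fun h => absurd h h5, fun h => ?_⟩
        rcases h with h | h | h
        · exact absurd h.symm n05
        · exact absurd h.symm n15
        · exact absurd h.symm n25
    rw [hU _ hp, iUnion_iUnion_eq_or_left, iUnion_iUnion_eq_or_left, iUnion_iUnion_eq_left, ← e11,
      ← (fan_interiors k (triEmbed y)).2.2.1]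
    congr 2
    rw [e11]
    ac_rfl
  · -- `240°`: `k+5, k, k+1, k+2`
    refine Or.inr (Or.inr (Or.inr (Or.inl ⟨hj, cut _ ?_⟩)))
    have hp : ∀ i, faceL y i ∈ K ↔ i = k + 5 ∨ i = k + 5 + 1 ∨ i = k + 5 + 1 + 1 ∨ i = k + 5 + 1 + 1 + 1 := by
      intro i
      rw [e51, e11]
      obtain ⟨c, rfl⟩ := split i
      have hc : c = 0 ∨ c = 1 ∨ c = 2 ∨ c = 3 ∨ c = 4 ∨ c = 5 := by fin_cases c <;> simp
      rcases hc with rfl | rfl | rfl | rfl | rfl | rfl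
      · rw [e0]; exact ⟨fun _ => Or.inr (Or.inl rfl), fun _ => hk0⟩
      · exact ⟨fun _ => Or.inr (Or.inr (Or.inl rfl)), fun _ => h1⟩
      · exact ⟨fun _ => Or.inr (Or.inr (Or.inr rfl)), fun _ => hK2⟩
      · refine ⟨fun h => absurd h hK3, fun h => ?_⟩
        rcases h with h | h | h | h
        · exact absurd (add_left_cancel h) (by decide)
        · exact absurd ((add_zero k).trans h.symm) (fun h => absurd (add_left_cancel h) (by decide))
        · exact absurd (add_left_cancel h) (by decide)
        · exact absurd (add_left_cancel h) (by decide)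
      · refine ⟨fun h => absurd h h4, fun h => ?_⟩
        rcases h with h | h | h | h
        · exact absurd h n54.symm
        · exact absurd h.symm n04
        · exact absurd h.symm n14
        · exact absurd h.symm n24
      · exact ⟨fun _ => Or.inl rfl, fun _ => h5⟩
    rw [hU _ hp, iUnion_iUnion_eq_or_left, iUnion_iUnion_eq_or_left, iUnion_iUnion_eq_or_left, iUnion_iUnion_eq_left,
      ← (fan_interiors (k + 5) (triEmbed y)).2.2.2.1]
    obtain ⟨e52, e53, -, -, -⟩ := fin6_succ' k
    congr 2
    rw [e51, e11, e52, e53]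
    ac_rfl
  · -- `300°`: `k+4, k+5, k, k+1, k+2`
    refine Or.inr (Or.inr (Or.inr (Or.inr ⟨hj, cut _ ?_⟩)))
    have hp : ∀ i, faceL y i ∈ K ↔
        i = k + 4 ∨ i = k + 4 + 1 ∨ i = k + 4 + 1 + 1 ∨ i = k + 4 + 1 + 1 + 1 ∨ i = k + 4 + 1 + 1 + 1 + 1 := by
      intro i
      rw [e41, e51, e11]
      obtain ⟨c, rfl⟩ := split i
      have hc : c = 0 ∨ c = 1 ∨ c = 2 ∨ c = 3 ∨ c = 4 ∨ c = 5 := by fin_cases c <;> simp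
      rcases hc with rfl | rfl | rfl | rfl | rfl | rfl
      · rw [e0]; exact ⟨fun _ => Or.inr (Or.inr (Or.inl rfl)), fun _ => hk0⟩
      · exact ⟨fun _ => Or.inr (Or.inr (Or.inr (Or.inl rfl))), fun _ => h1⟩
      · exact ⟨fun _ => Or.inr (Or.inr (Or.inr (Or.inr rfl))), fun _ => hK2⟩
      · refine ⟨fun h => absurd h hK3, fun h => ?_⟩
        rcases h with h | h | h | h | h
        · exact absurd (add_left_cancel h) (by decide)
        · exact absurd (add_left_cancel h) (by decide)
        · exact absurd ((add_zero k).trans h.symm) (fun h => absurd (add_left_cancel h) (by decide))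
        · exact absurd (add_left_cancel h) (by decide)
        · exact absurd (add_left_cancel h) (by decide)
      · exact ⟨fun _ => Or.inl rfl, fun _ => h4⟩
      · exact ⟨fun _ => Or.inr (Or.inl rfl), fun _ => h5⟩
    rw [hU _ hp, iUnion_iUnion_eq_or_left, iUnion_iUnion_eq_or_left, iUnion_iUnion_eq_or_left, iUnion_iUnion_eq_or_left,
      iUnion_iUnion_eq_left, ← (fan_interiors (k + 4) (triEmbed y)).2.2.2.2]
    obtain ⟨-, -, e42, e43, e44⟩ := fin6_succ' k
    congr 2
    rw [e41, e51, e11, e42, e43, e44]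
    ac_rfl

/-- **The inside at a vertex of the cycle** (registered form, sub-goal of `stub_innerZigzagPolygon`): it is
the interior of the union of the closed `K`-cells round the vertex, cut to the ball of radius `1/4`.
[folklore] -/
theorem inside_at_vertex : ∀ (K : Finset HexVertex) (d₀ : Site 2 × Fin 6) (Per : ℕ) (hs : IsSimpleClosedPolygon (bverts K 0 1 d₀ Per)) (V : Set ℂ), (IsOpen V ∧ Disjoint (polygonDomain (bverts K 0 1 d₀ Per) hs).carrier V ∧ (polygonDomain (bverts K 0 1 d₀ Per) hs).carrier ∪ V = (frontier (polygonDomain (bverts K 0 1 d₀ Per) hs).carrier)ᶜ ∧ frontier V = frontier (polygonDomain (bverts K 0 1 d₀ Per) hs).carrier) → (∀ (t : ℕ) (i : Fin 6), faceL ((bwalk K d₀ t).1 + triDir (bwalk K d₀ t).2) i ∈ K → triCellStrict (faceL ((bwalk K d₀ t).1 + triDir (bwalk K d₀ t).2) i) ⊆ (polygonDomain (bverts K 0 1 d₀ Per) hs).carrier) → (∀ (t : ℕ) (i : Fin 6), faceL ((bwalk K d₀ t).1 + triDir (bwalk K d₀ t).2) i ∉ K → triCellStrict (faceL ((bwalk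 K d₀ t).1 + triDir (bwalk K d₀ t).2) i) ⊆ V) → (∀ z ∈ frontier (polygonDomain (bverts K 0 1 d₀ Per) hs).carrier, ∃ t < Per, z ∈ triCell (faceL (bwalk K d₀ t).1 (bwalk K d₀ t).2) ∧ z ∈ triCell (faceL (bwalk K d₀ t).1 ((bwalk K d₀ t).2 + 5)) ∧ faceL (bwalk K d₀ t).1 (bwalk K d₀ t).2 ∈ K ∧ faceL (bwalk K d₀ t).1 ((bwalk K d₀ t).2 + 5) ∉ K) → ∀ t : ℕ, (polygonDomain (bverts K 0 1 d₀ Per) hs).carrier ∩ Metric.ball (triEmbed ((bwalk K d₀ t).1 + triDir (bwalk K d₀ t).2)) (1 / 4) = interior (⋃ i : Fin 6, ⋃ (_ : faceL ((bwalk K d₀ t).1 + triDir (bwalk K d₀ t).2) i ∈ K), triCell (faceL ((bwalk K d₀ t).1 + triDir (bwalk K d₀ t).2) i)) ∩ Metric.ball (triEmbed ((bwalk K d₀ t).1 + triDir (bwalk K d₀ t).2)) (1 / 4) :=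
  fun _ _ _ hs _ hV hin hout hΓ t => carrier_inter_ball_vertex hs hV hin hout hΓ t

end Summit.CriticalPhenomena.SAWScalingLimit.Theorems.PolygonParitySqueeze.InnerZigzag

end
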